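import Mathlib.NumberTheory.NumberField.Completion.FinitePlace
import Mathlib.LinearAlgebra.Finsupp.LinearCombination
import Mathlib.Analysis.SpecialFunctions.Log.Basic
import HarnessLib

/-!
# Arakelov divisors on the finite places of a number field and their (normalised) degree
# (Dupuy–Hilado, *The statement of Mochizuki's Corollary 3.12*, §2.4.2, §2.5.4–2.5.5, §3.4)

Dupuy–Hilado, arXiv:2004.13228 (pre-split text; Ramanujan J. **68** (2025)), read on the page
(corpus render `paper:arxiv-2004.13228`, chunks 6–8):

* §2.4.2: "Let `π` be a uniformizer of `K`. By the normalized valuation on `K` we mean the valuation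
  `ord_K` satisfying `ord_K(π) = 1`."
* §2.5.4: "For an Arakelov divisor `D = Σ_{v∈V(L)} a_v [v] ∈ Div̂(L)` then the Arakelov degree is
  given by `deĝ_L(D) = Σ_{v∤∞} n_v ln|κ(v)| + Σ_{v|∞} n_v`, and the normalized Arakelov degree is
  `deĝ̲_L(D) = deĝ_L(D)/[F:ℚ]`. … We will let `Div̂(L)_0` denote the divisors supported on `V(L)_0`.
  … for a maximal ideal `P_v` we have `|P_v| = |κ(v)| = p_v^{f_v}` is the cardinality of the
  residue field."
* §2.5.5 / §3.4 (the conversion formula): "`ln μ_{L_v}(t_v O_v) = ln‖t_v‖_v = −deĝ(ord_v(t_v)[v])`",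
  "`log μ̄_{F_{0,v}}(a_v O_v) = ln|a_v|_p = −deĝ(ord_v(a_v)[v])/[F_{0,v}:ℚ_p]`. This is will be used
  often in our conversions, and we include it because the normalizations are easy to mess up."

This file builds the NUMBER-FIELD side of these conversions on Mathlib: the finite places of `F` are
`IsDedekindDomain.HeightOneSpectrum (𝓞 F)`; `ln|κ(v)|` is `Real.log (Ideal.absNorm v.asIdeal)`
(`logNorm`); a divisor supported on finite places with REAL coefficients (`Div̂(F)_0 ⊗ ℝ`, which
contains the `ℚ`- and `ℤ[1/d]`-divisors Dupuy–Hilado use for pilot objects, Def. 3.1.1, §3.3,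
Thm. 3.10.1) is a finitely supported function `HeightOneSpectrum (𝓞 F) →₀ ℝ`; `deĝ` and the
normalised `deĝ̲ = deĝ/[F:ℚ]` are `ℝ`-linear maps; the normalised valuation `ord_v : F → ℤ` is read
off Mathlib's `v.valuation F : F → ℤᵐ⁰` (`ord_v(0) := 0`, a documented junk value); and the
conversion formula is the THEOREM `log_adicAbv_eq_neg_deg` : `ln‖x‖_v = −deĝ(ord_v(x)[v])`, where
`‖x‖_v = |κ(v)|^{−ord_v(x)}` is Mathlib's `NumberField.HeightOneSpectrum.adicAbv` (= the absolute
value `‖x‖_v = ‖x‖_{L_v}` of §2.5.3, `‖x‖_L = |N_{L/ℚ_p}(x)|_p`, §2.4.6).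

Deliberately NOT here: archimedean components of Arakelov divisors (`Σ_{v|∞} n_v`; not needed for
the pilot divisors, which are "supported only at finite places", Thm. 3.10.1), principal divisors
`div(f)` and the product formula, the passage to completions `F_v` and Haar measures (the measure
side of the conversion formula is the business of the tensor-packet/log-shell files of this
directory). `TODO(general form)`: `Div̂(L) = ⊕_{v∤∞} ℤ[v] ⊕ ⊕_{v|∞} ℝ[v]` with the archimedean
degree term.
-/

noncomputable section

namespace Literature.IUT.LogVolume

open NumberField IsDedekindDomain

variable (F : Type*) [Field F] [NumberField F]

/-! ## Finite places, `ln|κ(v)|`, and the normalised valuation `ord_v` -/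

/-- `ln|κ(v)|` — the log of the cardinality of the residue field at the finite place `v`
("`|P_v| = |κ(v)| = p_v^{f_v}` is the cardinality of the residue field", §2.5.4).
[cite: DupuyHilado2025, §2.5.4] -/
def logNorm (v : HeightOneSpectrum (𝓞 F)) : ℝ := Real.log (Ideal.absNorm v.asIdeal)

/-- `|κ(v)| > 1`, hence `ln|κ(v)| > 0`. [cite: DupuyHilado2025, §2.5.4] -/
theorem logNorm_pos (v : HeightOneSpectrum (𝓞 F)) : 0 < logNorm F v :=
  Real.log_pos (by exact_mod_cast NumberField.HeightOneSpectrum.one_lt_absNorm v)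

/-- The normalised valuation `ord_v : F → ℤ` at a finite place ("the valuation `ord_K` satisfying
`ord_K(π) = 1`", §2.4.2), read off Mathlib's multiplicative valuation `v.valuation F : F → ℤᵐ⁰`
(a uniformizer has valuation `exp(−1)` there) as `ord_v(x) := −log(v.valuation F x)`; junk value
`ord_v(0) = 0` (every use below is at `x ≠ 0`). [cite: DupuyHilado2025, §2.4.2] -/
def ord (v : HeightOneSpectrum (𝓞 F)) (x : F) : ℤ := -WithZero.log (v.valuation F x)

/-- `ord_v(0) = 0` (junk value, documented). [cite: DupuyHilado2025, §2.4.2] -/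
theorem ord_zero (v : HeightOneSpectrum (𝓞 F)) : ord F v 0 = 0 := by simp [ord]

/-- `ord_v(1) = 0`. [cite: DupuyHilado2025, §2.4.2] -/
theorem ord_one (v : HeightOneSpectrum (𝓞 F)) : ord F v 1 = 0 := by simp [ord]

/-- Normalisation: some `π ∈ F` has `ord_v(π) = 1` ("`ord_K(π) = 1`", §2.4.2).
[cite: DupuyHilado2025, §2.4.2] -/
theorem exists_ord_eq_one (v : HeightOneSpectrum (𝓞 F)) : ∃ π : F, ord F v π = 1 := by
  obtain ⟨π, hπ⟩ := v.valuation_exists_uniformizer F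
  exact ⟨π, by simp [ord, hπ]⟩

/-- `ord_v(xy) = ord_v(x) + ord_v(y)` for `x, y ≠ 0`. [cite: DupuyHilado2025, §2.4.2] -/
theorem ord_mul (v : HeightOneSpectrum (𝓞 F)) {x y : F} (hx : x ≠ 0) (hy : y ≠ 0) :
    ord F v (x * y) = ord F v x + ord F v y := by
  unfold ord
  rw [map_mul, WithZero.log_mul ((v.valuation F).ne_zero_iff.mpr hx)
    ((v.valuation F).ne_zero_iff.mpr hy)]
  ring

/-- `ord_v(x⁻¹) = −ord_v(x)`. [cite: DupuyHilado2025, §2.4.2] -/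
theorem ord_inv (v : HeightOneSpectrum (𝓞 F)) (x : F) : ord F v x⁻¹ = -ord F v x := by
  unfold ord
  rw [map_inv₀, WithZero.log_inv]

/-- `ord_v(x^n) = n·ord_v(x)`. [cite: DupuyHilado2025, §2.4.2] -/
theorem ord_pow (v : HeightOneSpectrum (𝓞 F)) (x : F) (n : ℕ) : ord F v (x ^ n) = n * ord F v x := by
  unfold ord
  rw [map_pow, WithZero.log_pow]
  simp

/-- Integers have `ord_v ≥ 0`. [cite: DupuyHilado2025, §2.4.2] -/
theorem ord_nonneg_of_isIntegral (v : HeightOneSpectrum (𝓞 F)) (x : 𝓞 F) : 0 ≤ ord F v (x : F) := by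
  unfold ord
  rw [neg_nonneg]
  by_cases hx : (x : F) = 0
  · simp [hx]
  · have hvx : v.valuation F (x : F) ≠ 0 := (v.valuation F).ne_zero_iff.mpr hx
    rw [← WithZero.log_one]
    exact (WithZero.log_le_log hvx one_ne_zero).mpr (v.valuation_le_one (K := F) x)

/-- An integer has `ord_v > 0` iff it lies in the prime `v`. [cite: DupuyHilado2025, §2.4.2] -/
theorem ord_pos_iff_mem (v : HeightOneSpectrum (𝓞 F)) (x : 𝓞 F) (hx : x ≠ 0) :
    0 < ord F v (x : F) ↔ x ∈ v.asIdeal := by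
  unfold ord
  have hx' : (x : F) ≠ 0 := by exact_mod_cast hx
  have hvx : v.valuation F (x : F) ≠ 0 := (v.valuation F).ne_zero_iff.mpr hx'
  rw [neg_pos, ← WithZero.log_one, WithZero.log_lt_log hvx one_ne_zero]
  exact v.valuation_lt_one_iff_mem (K := F) x

/-- Plumbing: `WithZero.log` of a non-zero element of `ℤᵐ⁰` is `toAdd` of its underlying element.
[folklore] -/
private theorem log_eq_toAdd_unzero {x : WithZero (Multiplicative ℤ)} (hx : x ≠ 0) :
    WithZero.log x = (WithZero.unzero hx).toAdd := by
  conv_lhs => rw [← WithZero.coe_unzero hx]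
  rfl

/-- Mathlib's `v`-adic absolute value is `‖x‖_v = |κ(v)|^{−ord_v(x)}` (`x ≠ 0`) — Dupuy–Hilado's
`‖x‖_v = ‖x‖_{L_v}`, `‖x‖_L = |N_{L/ℚ_p}(x)|_p = |x|_p^{[L:ℚ_p]}` (§2.4.6, §2.5.3).
[cite: DupuyHilado2025, §2.4.6, §2.5.3] -/
theorem adicAbv_eq_absNorm_zpow (v : HeightOneSpectrum (𝓞 F)) {x : F} (hx : x ≠ 0) :
    NumberField.HeightOneSpectrum.adicAbv F v x = (Ideal.absNorm v.asIdeal : ℝ) ^ (-ord F v x) := by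
  have hvx : v.valuation F x ≠ 0 := (v.valuation F).ne_zero_iff.mpr hx
  rw [NumberField.HeightOneSpectrum.adicAbv_def, WithZeroMulInt.toNNReal_neg_apply _ hvx, ord,
    log_eq_toAdd_unzero hvx, neg_neg]
  push_cast
  rfl

/-! ## Divisors supported on finite places and their degrees -/

/-- `Div̂(F)_0 ⊗ ℝ`: Arakelov divisors of `F` supported on the finite places, with real coefficients
— finitely supported functions `v ↦ a_v` ("`D = Σ a_v [v]`", §2.5.4; the pilot divisors of §3.3 have
coefficients in `ℚ`, those of Thm. 3.10.1 in `ℤ[1/d]`). [cite: DupuyHilado2025, §2.5.4] -/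
abbrev FinDivisor : Type _ := HeightOneSpectrum (𝓞 F) →₀ ℝ

namespace FinDivisor

variable {F}

/-- The prime divisor `[v]` with coefficient `a`: `a[v]`. [cite: DupuyHilado2025, §2.5.4] -/
abbrev of (v : HeightOneSpectrum (𝓞 F)) (a : ℝ) : FinDivisor F := Finsupp.single v a

variable (F) in
/-- The Arakelov degree on `Div̂(F)_0 ⊗ ℝ` as an `ℝ`-linear map: `deĝ_F(Σ a_v [v]) = Σ a_v ln|κ(v)|`
(§2.5.4, finite part). [cite: DupuyHilado2025, §2.5.4] -/
def deg : FinDivisor F →ₗ[ℝ] ℝ := Finsupp.linearCombination ℝ (logNorm F)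

/-- `deĝ(D) = Σ_{v ∈ supp D} a_v · ln|κ(v)|`. [cite: DupuyHilado2025, §2.5.4] -/
theorem deg_apply (D : FinDivisor F) : deg F D = D.sum (fun v a => a * logNorm F v) := by
  simp [deg, Finsupp.linearCombination_apply, smul_eq_mul]

/-- `deĝ(a[v]) = a · ln|κ(v)|` ("`ln|I| = deĝ(div(I)_0)`" for `I = P_v^a`, §2.5.4).
[cite: DupuyHilado2025, §2.5.4] -/
theorem deg_of (v : HeightOneSpectrum (𝓞 F)) (a : ℝ) : deg F (of v a) = a * logNorm F v := by
  simp [deg, of, Finsupp.linearCombination_single, smul_eq_mul]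

/-- `deĝ(Σ_{v∈S} a_v [v]) = Σ_{v∈S} a_v ln|κ(v)|` for a finite set of places `S`.
[cite: DupuyHilado2025, §2.5.4] -/
theorem deg_sum_of {ι : Type*} (S : Finset ι) (v : ι → HeightOneSpectrum (𝓞 F)) (a : ι → ℝ) :
    deg F (∑ i ∈ S, of (v i) (a i)) = ∑ i ∈ S, a i * logNorm F (v i) := by
  rw [map_sum]
  exact Finset.sum_congr rfl fun i _ => deg_of (v i) (a i)

/-- An effective divisor (`a_v ≥ 0`) has `deĝ ≥ 0`. [cite: DupuyHilado2025, §2.5.4] -/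
theorem deg_nonneg {D : FinDivisor F} (hD : ∀ v, 0 ≤ D v) : 0 ≤ deg F D := by
  rw [deg_apply]
  exact Finsupp.sum_nonneg fun v _ => mul_nonneg (hD v) (logNorm_pos F v).le

variable (F) in
/-- The NORMALISED Arakelov degree `deĝ̲_F(D) = deĝ_F(D)/[F:ℚ]` (§2.5.4: "If `L ⊂ L'` is a field
extension … then `deĝ̲_{L'}(φ^*D) = deĝ̲_L(D)`" — the normalisation that makes degrees
base-change invariant), as an `ℝ`-linear map. [cite: DupuyHilado2025, §2.5.4] -/
def ndeg : FinDivisor F →ₗ[ℝ] ℝ := (Module.finrank ℚ F : ℝ)⁻¹ • deg F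

/-- `deĝ̲(D) = deĝ(D)/[F:ℚ]`. [cite: DupuyHilado2025, §2.5.4] -/
theorem ndeg_apply (D : FinDivisor F) : ndeg F D = deg F D / Module.finrank ℚ F := by
  simp [ndeg, div_eq_inv_mul]

/-- `[F:ℚ] > 0` as a real number. [cite: DupuyHilado2025, §2.5.4] -/
theorem finrank_pos : (0 : ℝ) < Module.finrank ℚ F := by
  exact_mod_cast Module.finrank_pos

/-- `deĝ̲(a[v]) = a · ln|κ(v)|/[F:ℚ]`. [cite: DupuyHilado2025, §2.5.4] -/
theorem ndeg_of (v : HeightOneSpectrum (𝓞 F)) (a : ℝ) :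
    ndeg F (of v a) = a * logNorm F v / Module.finrank ℚ F := by
  rw [ndeg_apply, deg_of]

/-- An effective divisor has `deĝ̲ ≥ 0`. [cite: DupuyHilado2025, §2.5.4] -/
theorem ndeg_nonneg {D : FinDivisor F} (hD : ∀ v, 0 ≤ D v) : 0 ≤ ndeg F D := by
  rw [ndeg_apply]
  exact div_nonneg (deg_nonneg hD) (finrank_pos).le

end FinDivisor

/-! ## The conversion formula, number-field side -/

/-- **Conversion formula (number-field side)**: `ln‖x‖_v = −deĝ(ord_v(x)[v])` for `x ≠ 0` —
Dupuy–Hilado (2.5.5) "`ln μ_{L_v}(t_v O_v) = ln‖t_v‖_v = −deĝ(ord_v(t_v)[v])`", second equality;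
the first equality (Haar measure of `t_v O_v`) is the measure-theoretic side, not in this file.
[cite: DupuyHilado2025, §2.5.5] -/
theorem log_adicAbv_eq_neg_deg (v : HeightOneSpectrum (𝓞 F)) {x : F} (hx : x ≠ 0) :
    Real.log (NumberField.HeightOneSpectrum.adicAbv F v x) =
      -FinDivisor.deg F (FinDivisor.of v (ord F v x : ℝ)) := by
  rw [adicAbv_eq_absNorm_zpow F v hx, Real.log_zpow, FinDivisor.deg_of, logNorm]
  push_cast
  ring

/-- The same in the normalised form of §3.4, up to the local degree: for `x ≠ 0`,
`ln‖x‖_v /[F:ℚ] = −deĝ̲(ord_v(x)[v])` (divide (2.5.5) by `[F:ℚ]`; Dupuy–Hilado's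
"`ln|a_v|_p = −deĝ(ord_v(a_v)[v])/[F_{0,v}:ℚ_p]`" is this identity re-normalised by the local degree
`[F_{0,v}:ℚ_p]`, cf. `FakeAdeleIndex`). [cite: DupuyHilado2025, §3.4] -/
theorem log_adicAbv_div_finrank_eq_neg_ndeg (v : HeightOneSpectrum (𝓞 F)) {x : F} (hx : x ≠ 0) :
    Real.log (NumberField.HeightOneSpectrum.adicAbv F v x) / Module.finrank ℚ F =
      -FinDivisor.ndeg F (FinDivisor.of v (ord F v x : ℝ)) := by
  rw [log_adicAbv_eq_neg_deg F v hx, FinDivisor.ndeg_apply, neg_div]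

end Literature.IUT.LogVolume

end
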